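import Summits.AtomisticToContinuum.Crystallization.Theorems.FrustratedLawDichotomyVirial
import Summits.AtomisticToContinuum.Crystallization.Theorems.FrustratedLawDichotomyMinimisersInfinite

/-!
# FrustratedLawDichotomy · crux `AperiodicFrustratedLawGap` (stmt-AtomisticToContinuum-27623) — MINIMISING LAWS HAVE COMPRESSED PAIRS:
# the rung `δ ≥ 1` of both gap cruxes (decomp-a2c, prover hand 2, structural share, generation 2)

The virial identity `E_P[Σ ‖y‖⁻⁶] = E_P[Σ ‖y‖⁻¹²]` (`FrustratedLawDichotomyVirial.virial_of_minimising'`) kills every UNCOMPRESSED law: if all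
interatomic distances are `≥ 1` then `‖y‖⁻⁶ − ‖y‖⁻¹² ≥ 0` for every atom `y ≠ 0`, so the identity forces `‖y‖ = 1` for EVERY atom
`y ≠ 0` of almost every configuration — all atoms on the unit sphere about the root, hence finitely many (`1`-separated points of a ball) —
while Palm minimisers are almost surely carried by INFINITE configurations (`ae_infinite_of_minimising`, hand 2 generation 0).  Hence,
granted the floor of item 9229 (hypothesis `hU`):

* `finite_atoms_of_virial_zero` — a rooted `δ`-hard-core configuration with `δ ≥ 1` and `Σ_y (‖y‖⁻⁶ − ‖y‖⁻¹²) = 0` is finite;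
* `eStar_lt_integral_rootEnergy_of_one_le` — **every point-stationary `δ`-hard-core probability law with `δ ≥ 1` has `e⋆ < E_P[rootEnergy]`**:
  an exact Lennard-Jones minimiser among stationary laws has a COMPRESSED pair (distance `< 1`, inside the repulsive core) with positive
  probability;
* `aperiodicFrustratedLawGap_rungOne`, `periodicFrustratedLawGap_rungOne` — the two cruxes' statements VERBATIM with `1 ≤ δ` in place of
  `0 < δ` (the dilute window of the route now reaches the potential's equilibrium distance; birth rung `δ ≥ 3`, virial rung `δ ≥ 2.52`);
* `aperiodicFrustratedLawGap_iff_compressed` — EXACT CUT: the crux (route decl BY NAME) is equivalent to its restriction to hard cores `δ < 1`.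

All `[folklore]`.
-/

noncomputable section

namespace Summit.AtomisticToContinuum.Crystallization.Theorems.FrustratedLawDichotomyVirial

open MeasureTheory Metric Set Filter
open scoped ENNReal Topology BigOperators
open Literature.MathematicalPhysics.StatisticalMechanics Literature.Probability.Process
open Literature.Probability.Process.LocalConfig (finite_inter_of_separated)
open Summit.AtomisticToContinuum.Crystallization.Theorems.ChargedEnergyGapNegative (E3 eStar)
open Summit.AtomisticToContinuum.Crystallization.Theorems.FrustratedLawDichotomyFiniteClusterGap (setOf_count_restrict_singleton_ne_zero)
open Summit.AtomisticToContinuum.Crystallization.Theorems.FrustratedLawDichotomyAperiodicGapFiniteCut (ae_infinite_of_minimising)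

section CompressedPairs

variable {δ : ℝ} {μ : Measure E3} {P : Measure (Measure E3)}

/-- For an uncompressed configuration (`δ ≥ 1`) the virial integrand `‖y‖⁻⁶ − ‖y‖⁻¹²` is pointwise non-negative on the atoms. [folklore] -/
theorem virialIntegrand_nonneg_of_one_le (hδ : 1 ≤ δ) {S : Set E3} (h0 : (0 : E3) ∈ S)
    (hsep : ∀ x ∈ S, ∀ y ∈ S, x ≠ y → δ ≤ dist x y) {y : E3} (hy : y ∈ S) : 0 ≤ ‖y‖⁻¹ ^ 6 - ‖y‖⁻¹ ^ 12 := by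
  by_cases hy0 : y = 0
  · subst hy0; simp
  · have h1 : 1 ≤ ‖y‖ := by
      have h := hsep y hy 0 h0 hy0
      rw [dist_zero_right] at h
      exact hδ.trans h
    have ha0 : 0 ≤ ‖y‖⁻¹ := inv_nonneg.2 (norm_nonneg y)
    have ha1 : ‖y‖⁻¹ ≤ 1 := inv_le_one_of_one_le₀ h1
    have := pow_le_pow_of_le_one ha0 ha1 (show 6 ≤ 12 by norm_num)
    linarith

/-- **An uncompressed configuration with vanishing virial is finite**: if `μ` is a rooted `δ`-hard-core configuration with `δ ≥ 1` and
`∫ (‖y‖⁻⁶ − ‖y‖⁻¹²) dμ = 0`, then every atom `y ≠ 0` lies ON the unit sphere about the root, so there are finitely many atoms. [folklore] -/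
theorem finite_atoms_of_virial_zero (hδ : 1 ≤ δ) (hμ : IsRootedHardCore δ μ)
    (hzero : ∫ y, (‖y‖⁻¹ ^ 6 - ‖y‖⁻¹ ^ 12) ∂μ = 0) : {p : E3 | μ {p} ≠ 0}.Finite := by
  have hδ0 : 0 < δ := by linarith
  obtain ⟨hi6, hi12⟩ := integrable_invPow hδ0 hμ
  obtain ⟨S, h0, hsep, rfl⟩ := hμ
  rw [setOf_count_restrict_singleton_ne_zero]
  -- the integrand vanishes at every atom
  have hnn : 0 ≤ᵐ[(Measure.count : Measure E3).restrict S] fun y => ‖y‖⁻¹ ^ 6 - ‖y‖⁻¹ ^ 12 :=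
    (FrustratedLawDichotomyFiniteClusterGap.ae_mem_of_sep hδ0 hsep).mono fun y hy =>
      virialIntegrand_nonneg_of_one_le hδ h0 hsep hy
  have hae := (integral_eq_zero_iff_of_nonneg_ae hnn (hi6.sub hi12)).1 hzero
  have hpt : ∀ y ∈ S, ‖y‖⁻¹ ^ 6 - ‖y‖⁻¹ ^ 12 = 0 := by
    intro y hy
    by_contra hne
    have hnull : (Measure.count : Measure E3).restrict S {z | ‖z‖⁻¹ ^ 6 - ‖z‖⁻¹ ^ 12 ≠ 0} = 0 := ae_iff.1 hae
    have hle : (Measure.count : Measure E3).restrict S {y} ≤ (Measure.count : Measure E3).restrict S {z | ‖z‖⁻¹ ^ 6 - ‖z‖⁻¹ ^ 12 ≠ 0} :=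
      measure_mono (Set.singleton_subset_iff.2 hne)
    rw [hnull, nonpos_iff_eq_zero] at hle
    exact (count_restrict_singleton_ne_zero_iff S y).2 hy hle
  -- hence every atom lies in the closed unit ball
  have hsub : S ⊆ closedBall (0 : E3) 1 := by
    intro y hy
    rw [mem_closedBall, dist_zero_right]
    by_cases hy0 : y = 0
    · rw [hy0, norm_zero]; exact zero_le_one
    · have h1 : 1 ≤ ‖y‖ := by
        have h := hsep y hy 0 h0 hy0
        rw [dist_zero_right] at h
        exact hδ.trans h
      have hpos : 0 < ‖y‖ := by linarith
      have h := hpt y hy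
      -- `a⁶ = a¹²` with `0 < a ≤ 1` forces `a = 1`
      have ha : ‖y‖⁻¹ ^ 6 = 1 := by
        have hfac : ‖y‖⁻¹ ^ 6 * (1 - ‖y‖⁻¹ ^ 6) = 0 := by nlinarith [h]
        rcases mul_eq_zero.1 hfac with h6 | h6
        · exact absurd h6 (pow_ne_zero 6 (inv_ne_zero hpos.ne'))
        · linarith
      have hinv : ‖y‖⁻¹ = 1 := (pow_eq_one_iff_of_nonneg (inv_nonneg.2 hpos.le) (by norm_num : (6 : ℕ) ≠ 0)).1 ha
      have : ‖y‖ = 1 := by rw [← inv_inv ‖y‖, hinv, inv_one]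
      exact this.le
  -- a separated subset of a ball is finite
  have hfin : (closedBall (0 : E3) 1 ∩ S).Finite := finite_inter_of_separated hδ0 hsep (isCompact_closedBall (0 : E3) 1)
  exact hfin.subset fun y hy => ⟨hsub hy, hy⟩

/-- **MINIMISING LAWS HAVE COMPRESSED PAIRS — the rung `δ ≥ 1`.**  Granted the energy floor for point-stationary hard-core probability laws
(item 9229, hypothesis `hU`), every point-stationary `δ`-hard-core probability law with `δ ≥ 1` has mean root energy STRICTLY above `e⋆`.
Proof: a minimiser satisfies the virial identity `E_P ∫ (‖y‖⁻⁶ − ‖y‖⁻¹²) dμ = 0` with a.s. non-negative integrand, so almost every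
configuration is finite by `finite_atoms_of_virial_zero`, contradicting `ae_infinite_of_minimising`. [folklore] -/
theorem eStar_lt_integral_rootEnergy_of_one_le
    (hU : ∀ δ' : ℝ, 0 < δ' → ∀ Q : Measure (Measure E3), IsProbabilityMeasure Q → (∀ᵐ μ ∂Q, IsRootedHardCore δ' μ) →
      IsPointStationaryLaw Q → eStar ≤ ∫ μ, rootEnergy lennardJones μ ∂Q)
    (hδ : 1 ≤ δ) [IsProbabilityMeasure P] (hcore : ∀ᵐ μ ∂P, IsRootedHardCore δ μ) (hstat : IsPointStationaryLaw P) :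
    eStar < ∫ μ, rootEnergy lennardJones μ ∂P := by
  have hδ0 : 0 < δ := by linarith
  by_contra hlt
  have hmin := not_lt.mp hlt
  obtain ⟨hvir, -, -⟩ := virial_of_minimising' hU hδ0 hcore hstat hmin
  have hinf := ae_infinite_of_minimising hU hδ0 hcore hstat hmin
  -- the virial integrals, configuration by configuration
  obtain ⟨hI6, hI12⟩ := integrable_moments hδ0 hcore
  have hB6 : Integrable (fun μ : Measure E3 => ∫ y, ‖y‖⁻¹ ^ 6 ∂μ) P :=
    hI6.congr (hcore.mono fun μ hμ => ((integral_invPow_eq_toReal hδ0 hμ).1).symm)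
  have hB12 : Integrable (fun μ : Measure E3 => ∫ y, ‖y‖⁻¹ ^ 12 ∂μ) P :=
    hI12.congr (hcore.mono fun μ hμ => ((integral_invPow_eq_toReal hδ0 hμ).2).symm)
  have hsplit : ∀ᵐ μ ∂P, ∫ y, (‖y‖⁻¹ ^ 6 - ‖y‖⁻¹ ^ 12) ∂μ = ∫ y, ‖y‖⁻¹ ^ 6 ∂μ - ∫ y, ‖y‖⁻¹ ^ 12 ∂μ :=
    hcore.mono fun μ hμ => by
      obtain ⟨hi6, hi12⟩ := integrable_invPow hδ0 hμ
      exact integral_sub hi6 hi12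
  have hzero : ∫ μ, ∫ y, (‖y‖⁻¹ ^ 6 - ‖y‖⁻¹ ^ 12) ∂μ ∂P = 0 := by
    rw [integral_congr_ae hsplit, integral_sub hB6 hB12, hvir, sub_self]
  have hnn : 0 ≤ᵐ[P] fun μ : Measure E3 => ∫ y, (‖y‖⁻¹ ^ 6 - ‖y‖⁻¹ ^ 12) ∂μ :=
    hcore.mono fun μ hμ => by
      obtain ⟨S, h0, hsep, rfl⟩ := hμ
      exact integral_nonneg_of_ae ((FrustratedLawDichotomyFiniteClusterGap.ae_mem_of_sep hδ0 hsep).mono fun y hy =>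
        virialIntegrand_nonneg_of_one_le hδ h0 hsep hy)
  have hint : Integrable (fun μ : Measure E3 => ∫ y, (‖y‖⁻¹ ^ 6 - ‖y‖⁻¹ ^ 12) ∂μ) P := (hB6.sub hB12).congr (hsplit.mono fun μ h => h.symm)
  have hae := (integral_eq_zero_iff_of_nonneg_ae hnn hint).1 hzero
  -- almost every configuration is finite AND infinite
  have hfalse : ∀ᵐ μ ∂P, False := by
    filter_upwards [hcore, hae, hinf] with μ hμ hμ0 hμinf
    exact hμinf (finite_atoms_of_virial_zero hδ hμ hμ0)
  exact IsProbabilityMeasure.ne_zero P (ae_eq_bot.1 (Filter.eventually_false_iff_eq_bot.1 hfalse))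

/-- **RUNG `δ ≥ 1` OF THE CRUX `AperiodicFrustratedLawGap`** (its statement verbatim with `1 ≤ δ` in place of `0 < δ`; texture, Nash and
aperiodicity idle), granted the floor of item 9229. [folklore] -/
theorem aperiodicFrustratedLawGap_rungOne
    (hU : ∀ δ' : ℝ, 0 < δ' → ∀ Q : MeasureTheory.Measure (MeasureTheory.Measure (EuclideanSpace ℝ (Fin 3))), MeasureTheory.IsProbabilityMeasure Q →
      (∀ᵐ μ ∂Q, Literature.Probability.Process.IsRootedHardCore δ' μ) → Literature.Probability.Process.IsPointStationaryLaw Q →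
      (⨅ Q : Literature.MathematicalPhysics.StatisticalMechanics.PeriodicConfiguration 3, Q.energyPerParticle Literature.MathematicalPhysics.StatisticalMechanics.lennardJones) ≤
        ∫ μ, Literature.MathematicalPhysics.StatisticalMechanics.rootEnergy Literature.MathematicalPhysics.StatisticalMechanics.lennardJones μ ∂Q) :
    ∀ δ : ℝ, 1 ≤ δ → ∀ P : MeasureTheory.Measure (MeasureTheory.Measure (EuclideanSpace ℝ (Fin 3))), let Gy : ℝ → (N : ℕ) → (Fin N → EuclideanSpace ℝ (Fin 3)) → Fin N → Prop := fun η N y j => let d : ℝ := sInf ((fun z => dist z (y (j : Fin N))) '' (Set.range (y) \ {(y (j : Fin N))})); let T : Set (EuclideanSpace ℝ (Fin 3)) := {z : EuclideanSpace ℝ (Fin 3) | z ∈ Set.range (y) ∧ z ≠ (y (j : Fin N)) ∧ dist z (y (j : Fin N)) < 13 / 10 * d}; ∃ A : EuclideanSpace ℝ (Fin 3) →ₗᵢ[ℝ] EuclideanSpace ℝ (Fin 3), (∃ e : ↥T ≃ ↥Literature.Geometry.DiscreteGeometry.fccKissingPattern, ∀ t : ↥T, dist (d⁻¹ • ((t :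 EuclideanSpace ℝ (Fin 3)) - (y (j : Fin N)))) (A ((e t : ↥Literature.Geometry.DiscreteGeometry.fccKissingPattern) : EuclideanSpace ℝ (Fin 3))) ≤ η) ∨ (∃ e : ↥T ≃ ↥Literature.Geometry.DiscreteGeometry.hcpKissingPattern, ∀ t : ↥T, dist (d⁻¹ • ((t : EuclideanSpace ℝ (Fin 3)) - (y (j : Fin N)))) (A ((e t : ↥Literature.Geometry.DiscreteGeometry.hcpKissingPattern) : EuclideanSpace ℝ (Fin 3))) ≤ η); let TexBall : (N : ℕ) → (Fin N → EuclideanSpace ℝ (Fin 3)) → Fin N → ℝ → ℝ → ℝ → ℝ → Prop := fun N y i R R₇ R₈ R₉ => (∀ a b : Fin N, a ≠ b → (7 : ℝ) / 10 ≤ dist (y a) (y b)) ∧ (∀ j : Fin N, dist (y j) (y i) ≤ R → ¬ Gy (1 / 20) N (y) j) ∧ (∀ j : Fin N, dist (y j) (y i) ≤ R → ¬ ((∀ j' : Fin N, dist (y j') (y j) ≤ R₇ → ¬ Gy (1 / 20) N (y) j') ∧ (∀ z : EuclideanSpace ℝ (Fin 3), dist z (y j) ≤ R₇ → ∃ k :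 Fin N, dist z (y k) ≤ 1) ∧ (∀ j' : Fin N, dist (y j') (y j) ≤ R₇ → (let d : ℝ := sInf ((fun z => dist z (y j')) '' (Set.range (y) \ {(y j')})); ∀ k : Fin N, y k ≠ y j' → dist (y k) (y j') < 27 / 20 * d → 5 ≤ Nat.card {m : Fin N // y m ≠ y j' ∧ dist (y m) (y j') < 27 / 20 * d ∧ y m ≠ y k ∧ dist (y m) (y k) < 27 / 20 * d})))) ∧ (∀ j : Fin N, dist (y j) (y i) ≤ R → ∃ k : Fin N, dist (y k) (y j) ≤ R₈ ∧ Gy (1 / 8) N (y) k) ∧ (∀ j : Fin N, dist (y j) (y i) ≤ R → ¬ ((∀ j' : Fin N, dist (y j') (y j) ≤ R₉ → ¬ Gy (1 / 20) N (y) j') ∧ (Nat.card {j' : Fin N // dist (y j') (y j) ≤ R₉ ∧ ¬ Gy (1 / 8) N (y) j'} : ℝ) ≤ 1 / 2 * (Nat.card {j' : Fin N // dist (y j') (y j) ≤ R₉} : ℝ) ∧ (∀ j' : Fin N, dist (y j') (y j) ≤ R₉ → ¬ Gy (1 / 8) N (y) j' → ¬ (let d : ℝ := sInf ((fun z => dist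 z (y j')) '' (Set.range (y) \ {(y j')})); ∀ k : Fin N, y k ≠ y j' → dist (y k) (y j') < 27 / 20 * d → 5 ≤ Nat.card {m : Fin N // y m ≠ y j' ∧ dist (y m) (y j') < 27 / 20 * d ∧ y m ≠ y k ∧ dist (y m) (y k) < 27 / 20 * d})))); let Appr : MeasureTheory.Measure (EuclideanSpace ℝ (Fin 3)) → ℝ → ℝ → ℝ → Prop := fun μ R₇ R₈ R₉ => ∀ q : EuclideanSpace ℝ (Fin 3), μ {q} ≠ 0 → ∀ R ε : ℝ, 0 < ε → ∃ (N : ℕ) (y : Fin N → EuclideanSpace ℝ (Fin 3)) (i : Fin N), TexBall N y i R R₇ R₈ R₉ ∧ (∀ p : EuclideanSpace ℝ (Fin 3), μ {p} ≠ 0 → dist p q ≤ R → ∃ k : Fin N, dist (y k - y i) (p - q) ≤ ε) ∧ (∀ k : Fin N, dist (y k) (y i) ≤ R → ∃ p : EuclideanSpace ℝ (Fin 3), μ {p} ≠ 0 ∧ dist (y k - y i) (p - q) ≤ ε); MeasureTheory.IsProbabilityMeasure P → (∀ᵐ μ ∂P, Literature.Probability.Process.IsRootedHardCore δ μ) → Literature.Probability.Process.IsPointStationaryLaw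 P → (∃ R₇ R₈ R₉ : ℝ, ∀ᵐ μ ∂P, Appr μ R₇ R₈ R₉) → (∀ᵐ μ ∂P, ∀ p : EuclideanSpace ℝ (Fin 3), μ {p} ≠ 0 → ∀ y : EuclideanSpace ℝ (Fin 3), (∀ q : EuclideanSpace ℝ (Fin 3), μ {q} ≠ 0 → q ≠ p → y ≠ q) → ∑' q : {q : EuclideanSpace ℝ (Fin 3) // μ {q} ≠ 0 ∧ q ≠ p}, Literature.MathematicalPhysics.StatisticalMechanics.lennardJones (dist p (q : EuclideanSpace ℝ (Fin 3))) ≤ ∑' q : {q : EuclideanSpace ℝ (Fin 3) // μ {q} ≠ 0 ∧ q ≠ p}, Literature.MathematicalPhysics.StatisticalMechanics.lennardJones (dist y (q : EuclideanSpace ℝ (Fin 3)))) → P {μ : MeasureTheory.Measure (EuclideanSpace ℝ (Fin 3)) | ∃ Q : Literature.MathematicalPhysics.StatisticalMechanics.PeriodicConfiguration 3, ∃ t : EuclideanSpace ℝ (Fin 3), {p : EuclideanSpace ℝ (Fin 3) | μ {p} ≠ 0} = (fun s => s + t) '' Q.points} = 0 → (⨅ Q : Literature.MathematicalPhysics.StatisticalMechanics.PeriodicConfiguration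 3, Q.energyPerParticle Literature.MathematicalPhysics.StatisticalMechanics.lennardJones) < (∫ μ, Literature.MathematicalPhysics.StatisticalMechanics.rootEnergy Literature.MathematicalPhysics.StatisticalMechanics.lennardJones μ ∂P) := by
  intro δ hδ P
  dsimp only
  intro hP ha hb _ _ _
  exact eStar_lt_integral_rootEnergy_of_one_le hU hδ ha hb

/-- **RUNG `δ ≥ 1` OF THE CRUX `PeriodicFrustratedLawGap`** (its statement verbatim with `1 ≤ δ` in place of `0 < δ`; texture, Nash and
periodic charge idle), granted the floor of item 9229. [folklore] -/
theorem periodicFrustratedLawGap_rungOne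
    (hU : ∀ δ' : ℝ, 0 < δ' → ∀ Q : MeasureTheory.Measure (MeasureTheory.Measure (EuclideanSpace ℝ (Fin 3))), MeasureTheory.IsProbabilityMeasure Q →
      (∀ᵐ μ ∂Q, Literature.Probability.Process.IsRootedHardCore δ' μ) → Literature.Probability.Process.IsPointStationaryLaw Q →
      (⨅ Q : Literature.MathematicalPhysics.StatisticalMechanics.PeriodicConfiguration 3, Q.energyPerParticle Literature.MathematicalPhysics.StatisticalMechanics.lennardJones) ≤
        ∫ μ, Literature.MathematicalPhysics.StatisticalMechanics.rootEnergy Literature.MathematicalPhysics.StatisticalMechanics.lennardJones μ ∂Q) :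
    ∀ δ : ℝ, 1 ≤ δ → ∀ P : MeasureTheory.Measure (MeasureTheory.Measure (EuclideanSpace ℝ (Fin 3))), let Gy : ℝ → (N : ℕ) → (Fin N → EuclideanSpace ℝ (Fin 3)) → Fin N → Prop := fun η N y j => let d : ℝ := sInf ((fun z => dist z (y (j : Fin N))) '' (Set.range (y) \ {(y (j : Fin N))})); let T : Set (EuclideanSpace ℝ (Fin 3)) := {z : EuclideanSpace ℝ (Fin 3) | z ∈ Set.range (y) ∧ z ≠ (y (j : Fin N)) ∧ dist z (y (j : Fin N)) < 13 / 10 * d}; ∃ A : EuclideanSpace ℝ (Fin 3) →ₗᵢ[ℝ] EuclideanSpace ℝ (Fin 3), (∃ e : ↥T ≃ ↥Literature.Geometry.DiscreteGeometry.fccKissingPattern, ∀ t : ↥T, dist (d⁻¹ • ((t : EuclideanSpace ℝ (Fin 3)) - (y (j : Fin N)))) (A ((e t : ↥Literature.Geometry.DiscreteGeometry.fccKissingPattern) : EuclideanSpace ℝ (Fin 3))) ≤ η) ∨ (∃ e : ↥T ≃ ↥Literature.Geometry.DiscreteGeometry.hcpKissingPattern, ∀ t : ↥T, dist (d⁻¹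 • ((t : EuclideanSpace ℝ (Fin 3)) - (y (j : Fin N)))) (A ((e t : ↥Literature.Geometry.DiscreteGeometry.hcpKissingPattern) : EuclideanSpace ℝ (Fin 3))) ≤ η); let TexBall : (N : ℕ) → (Fin N → EuclideanSpace ℝ (Fin 3)) → Fin N → ℝ → ℝ → ℝ → ℝ → Prop := fun N y i R R₇ R₈ R₉ => (∀ a b : Fin N, a ≠ b → (7 : ℝ) / 10 ≤ dist (y a) (y b)) ∧ (∀ j : Fin N, dist (y j) (y i) ≤ R → ¬ Gy (1 / 20) N (y) j) ∧ (∀ j : Fin N, dist (y j) (y i) ≤ R → ¬ ((∀ j' : Fin N, dist (y j') (y j) ≤ R₇ → ¬ Gy (1 / 20) N (y) j') ∧ (∀ z : EuclideanSpace ℝ (Fin 3), dist z (y j) ≤ R₇ → ∃ k : Fin N, dist z (y k) ≤ 1) ∧ (∀ j' : Fin N, dist (y j') (y j) ≤ R₇ → (let d : ℝ := sInf ((fun z => dist z (y j')) '' (Set.range (y) \ {(y j')})); ∀ k : Fin N, y k ≠ y j' → dist (y k) (y j') < 27 / 20 * d → 5 ≤ Nat.card {m : Fin N // y m ≠ y j'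 ∧ dist (y m) (y j') < 27 / 20 * d ∧ y m ≠ y k ∧ dist (y m) (y k) < 27 / 20 * d})))) ∧ (∀ j : Fin N, dist (y j) (y i) ≤ R → ∃ k : Fin N, dist (y k) (y j) ≤ R₈ ∧ Gy (1 / 8) N (y) k) ∧ (∀ j : Fin N, dist (y j) (y i) ≤ R → ¬ ((∀ j' : Fin N, dist (y j') (y j) ≤ R₉ → ¬ Gy (1 / 20) N (y) j') ∧ (Nat.card {j' : Fin N // dist (y j') (y j) ≤ R₉ ∧ ¬ Gy (1 / 8) N (y) j'} : ℝ) ≤ 1 / 2 * (Nat.card {j' : Fin N // dist (y j') (y j) ≤ R₉} : ℝ) ∧ (∀ j' : Fin N, dist (y j') (y j) ≤ R₉ → ¬ Gy (1 / 8) N (y) j' → ¬ (let d : ℝ := sInf ((fun z => dist z (y j')) '' (Set.range (y) \ {(y j')})); ∀ k : Fin N, y k ≠ y j' → dist (y k) (y j') < 27 / 20 * d → 5 ≤ Nat.card {m : Fin N // y m ≠ y j' ∧ dist (y m) (y j') < 27 / 20 * d ∧ y m ≠ y k ∧ dist (y m) (y k) < 27 / 20 * d})))); let Appr : MeasureTheory.Measure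 (EuclideanSpace ℝ (Fin 3)) → ℝ → ℝ → ℝ → Prop := fun μ R₇ R₈ R₉ => ∀ q : EuclideanSpace ℝ (Fin 3), μ {q} ≠ 0 → ∀ R ε : ℝ, 0 < ε → ∃ (N : ℕ) (y : Fin N → EuclideanSpace ℝ (Fin 3)) (i : Fin N), TexBall N y i R R₇ R₈ R₉ ∧ (∀ p : EuclideanSpace ℝ (Fin 3), μ {p} ≠ 0 → dist p q ≤ R → ∃ k : Fin N, dist (y k - y i) (p - q) ≤ ε) ∧ (∀ k : Fin N, dist (y k) (y i) ≤ R → ∃ p : EuclideanSpace ℝ (Fin 3), μ {p} ≠ 0 ∧ dist (y k - y i) (p - q) ≤ ε); MeasureTheory.IsProbabilityMeasure P → (∀ᵐ μ ∂P, Literature.Probability.Process.IsRootedHardCore δ μ) → Literature.Probability.Process.IsPointStationaryLaw P → (∃ R₇ R₈ R₉ : ℝ, ∀ᵐ μ ∂P, Appr μ R₇ R₈ R₉) → (∀ᵐ μ ∂P, ∀ p : EuclideanSpace ℝ (Fin 3), μ {p} ≠ 0 → ∀ y : EuclideanSpace ℝ (Fin 3), (∀ q : EuclideanSpace ℝ (Fin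 3), μ {q} ≠ 0 → q ≠ p → y ≠ q) → ∑' q : {q : EuclideanSpace ℝ (Fin 3) // μ {q} ≠ 0 ∧ q ≠ p}, Literature.MathematicalPhysics.StatisticalMechanics.lennardJones (dist p (q : EuclideanSpace ℝ (Fin 3))) ≤ ∑' q : {q : EuclideanSpace ℝ (Fin 3) // μ {q} ≠ 0 ∧ q ≠ p}, Literature.MathematicalPhysics.StatisticalMechanics.lennardJones (dist y (q : EuclideanSpace ℝ (Fin 3)))) → 0 < P {μ : MeasureTheory.Measure (EuclideanSpace ℝ (Fin 3)) | ∃ Q : Literature.MathematicalPhysics.StatisticalMechanics.PeriodicConfiguration 3, ∃ t : EuclideanSpace ℝ (Fin 3), {p : EuclideanSpace ℝ (Fin 3) | μ {p} ≠ 0} = (fun s => s + t) '' Q.points} → (⨅ Q : Literature.MathematicalPhysics.StatisticalMechanics.PeriodicConfiguration 3, Q.energyPerParticle Literature.MathematicalPhysics.StatisticalMechanics.lennardJones) < (∫ μ, Literature.MathematicalPhysics.StatisticalMechanics.rootEnergy Literature.MathematicalPhysics.StatisticalMechanics.lennardJones μ ∂P) := by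
  intro δ hδ P
  dsimp only
  intro hP ha hb _ _ _
  exact eStar_lt_integral_rootEnergy_of_one_le hU hδ ha hb

end CompressedPairs

end Summit.AtomisticToContinuum.Crystallization.Theorems.FrustratedLawDichotomyVirial

end
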